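import Literature.AnabelianGeometry.AbsoluteAnabelian.AbsTopICharacterRank
import HarnessLib

/-!
# [AbsTopI] Lemma 4.5 (ii): further PROVED properties of the quasi-trivial rank `τ(M)`

Proof-only companion of `AbsTopICharacterRank.lean` (S. Mochizuki, *Topics in Absolute Anabelian
Geometry I*, Lemma 4.5 (ii), kurims manuscript p. 54 [MochizukiAbsTopI2012]): non-vacuity and
invariance statements about `quasiTrivialRank` that consumers of the typed Lemma 4.5 (ii)/(iii)
use.  No new definitions.

* `quasiTrivialRank_eq_finrank_of_quasiTrivial`: if the whole representation is quasi-trivial (an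
  open subgroup of finite index acts trivially — abc-iut-L4-t4's `IsQuasiTrivial`), then
  `τ(M) = dim M` (the one-step filtration `M ⊇ 0` has a quasi-trivial step).
* `quasiTrivialRank_eq_of_equivariant`, `dChi_eq_of_equivariant`: `τ` and `d_χ` are invariant
  under isomorphisms of representations (an intertwining linear equivalence transports stable
  chains, quasi-trivial steps, twists and duals) — the functorial nature of the invariants.
-/

noncomputable section

open scoped Classical

namespace Literature.AnabelianGeometry.AbsoluteAnabelian.AbsTopI

universe u v w w'

variable {G : Type u} [Group G] [TopologicalSpace G]
variable {K : Type v} [Field K] {M : Type w} [AddCommGroup M] [Module K M]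
variable {M' : Type w'} [AddCommGroup M'] [Module K M']

/-- Non-vacuity: if an open subgroup of finite index acts trivially on all of `M` (the
representation is quasi-trivial), then `τ(M) = dim M` — the one-step filtration `M ⊇ 0` has a
quasi-trivial step. [cite: MochizukiAbsTopI2012, Lemma 4.5 (ii) p.54] -/
theorem quasiTrivialRank_eq_finrank_of_quasiTrivial [FiniteDimensional K M] (ρ : G →* (M ≃ₗ[K] M))
    (h : ∃ U : Subgroup G, IsOpen (U : Set G) ∧ U.FiniteIndex ∧ ∀ g ∈ U, ρ g = 1) :
    quasiTrivialRank ρ = Module.finrank K M := by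
  refine le_antisymm (quasiTrivialRank_le_finrank ρ) ?_
  have hstep : IsQuasiTrivialStep ρ ⊤ ⊥ := by
    obtain ⟨U, hU, hfi, hact⟩ := h
    exact ⟨U, hU, hfi, fun g hg m _ => by simp [hact g hg]⟩
  have h0 : (StableChain.trivial ρ).term 0 = ⊤ := rfl
  have h1 : (StableChain.trivial ρ).term (0 + 1) = ⊥ := rfl
  have hq : (StableChain.trivial ρ).qtDim = Module.finrank K M := by
    unfold StableChain.qtDim
    rw [show (StableChain.trivial ρ).length = 1 from rfl, Finset.range_one, Finset.sum_singleton, h0,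
      h1, if_pos hstep, finrank_top, finrank_bot, Nat.sub_zero]
  rw [← hq]
  exact (StableChain.trivial ρ).qtDim_le_quasiTrivialRank

/-- An intertwining linear equivalence `e : M ≃ M'` (`e ∘ ρ(g) = ρ'(g) ∘ e`) transports quasi-trivial
steps. [cite: MochizukiAbsTopI2012, Lemma 4.5 (ii) p.54] -/
theorem IsQuasiTrivialStep.map_equivariant {ρ : G →* (M ≃ₗ[K] M)} {ρ' : G →* (M' ≃ₗ[K] M')}
    (e : M ≃ₗ[K] M') (he : ∀ g m, e (ρ g m) = ρ' g (e m)) {N N' : Submodule K M}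
    (h : IsQuasiTrivialStep ρ N N') :
    IsQuasiTrivialStep ρ' (N.map (e : M →ₗ[K] M')) (N'.map (e : M →ₗ[K] M')) := by
  obtain ⟨U, hU, hfi, hact⟩ := h
  refine ⟨U, hU, hfi, fun g hg m' hm' => ?_⟩
  obtain ⟨m, hm, rfl⟩ := Submodule.mem_map.1 hm'
  refine Submodule.mem_map.2 ⟨ρ g m - m, hact g hg m hm, ?_⟩
  simp [map_sub, he]

omit [TopologicalSpace G] in
/-- An intertwining linear equivalence transports stable submodules.
[cite: MochizukiAbsTopI2012, Lemma 4.5 (ii) p.54] -/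
theorem IsStable.map_equivariant {ρ : G →* (M ≃ₗ[K] M)} {ρ' : G →* (M' ≃ₗ[K] M')}
    (e : M ≃ₗ[K] M') (he : ∀ g m, e (ρ g m) = ρ' g (e m)) {N : Submodule K M} (h : IsStable ρ N) :
    IsStable ρ' (N.map (e : M →ₗ[K] M')) := by
  intro g m' hm'
  obtain ⟨m, hm, rfl⟩ := Submodule.mem_map.1 hm'
  exact Submodule.mem_map.2 ⟨ρ g m, h g m hm, he g m⟩

/-- `τ` does not decrease along an intertwining linear equivalence.
[cite: MochizukiAbsTopI2012, Lemma 4.5 (ii) p.54] -/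
theorem quasiTrivialRank_le_of_equivariant [FiniteDimensional K M] [FiniteDimensional K M']
    {ρ : G →* (M ≃ₗ[K] M)} {ρ' : G →* (M' ≃ₗ[K] M')} (e : M ≃ₗ[K] M')
    (he : ∀ g m, e (ρ g m) = ρ' g (e m)) : quasiTrivialRank ρ ≤ quasiTrivialRank ρ' := by
  refine csSup_le ⟨_, ⟨StableChain.trivial ρ, rfl⟩⟩ ?_
  rintro _ ⟨c, rfl⟩
  let f : M →ₗ[K] M' := e
  let c' : StableChain ρ' :=
    { length := c.length
      term := fun j => (c.term j).map f
      term_zero := by simp [c.term_zero, f, Submodule.map_top, LinearMap.range_eq_top.2 e.surjective]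
      term_length := by simp [c.term_length]
      step_le := fun j hj => Submodule.map_mono (c.step_le j hj)
      stable := fun j => IsStable.map_equivariant e he (c.stable j) }
  have hdim : ∀ j, Module.finrank K ((c.term j).map f) = Module.finrank K (c.term j) := fun j =>
    (LinearEquiv.finrank_eq (Submodule.equivMapOfInjective f e.injective (c.term j))).symm
  have hle : c.qtDim ≤ c'.qtDim := by
    unfold StableChain.qtDim
    refine Finset.sum_le_sum fun j _ => ?_
    by_cases hq : IsQuasiTrivialStep ρ (c.term j) (c.term (j + 1))
    · have hq' : IsQuasiTrivialStep ρ' (c'.term j) (c'.term (j + 1)) := hq.map_equivariant e he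
      rw [if_pos hq, if_pos hq']
      show _ ≤ Module.finrank K ((c.term j).map f) - Module.finrank K ((c.term (j + 1)).map f)
      rw [hdim, hdim]
    · rw [if_neg hq]; exact Nat.zero_le _
  exact hle.trans c'.qtDim_le_quasiTrivialRank

/-- **`τ` is an invariant of the isomorphism class of the representation**: an intertwining linear
equivalence `e : M ≃ M'` gives `τ(M) = τ(M')`. [cite: MochizukiAbsTopI2012, Lemma 4.5 (ii) p.54] -/
theorem quasiTrivialRank_eq_of_equivariant [FiniteDimensional K M] [FiniteDimensional K M']
    {ρ : G →* (M ≃ₗ[K] M)} {ρ' : G →* (M' ≃ₗ[K] M')} (e : M ≃ₗ[K] M')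
    (he : ∀ g m, e (ρ g m) = ρ' g (e m)) : quasiTrivialRank ρ = quasiTrivialRank ρ' := by
  refine le_antisymm (quasiTrivialRank_le_of_equivariant e he) ?_
  refine quasiTrivialRank_le_of_equivariant e.symm fun g m' => ?_
  apply e.injective
  simp [he]

omit [TopologicalSpace G] in
/-- An intertwining linear equivalence also intertwines the twists by any character.
[cite: MochizukiAbsTopI2012, Lemma 4.5 (ii) p.54] -/
theorem twist_equivariant {ρ : G →* (M ≃ₗ[K] M)} {ρ' : G →* (M' ≃ₗ[K] M')} (e : M ≃ₗ[K] M')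
    (he : ∀ g m, e (ρ g m) = ρ' g (e m)) (χ : G →* Kˣ) (g : G) (m : M) :
    e (twist ρ χ g m) = twist ρ' χ g (e m) := by
  rw [twist_apply, twist_apply, map_smul, he]

omit [TopologicalSpace G] in
/-- An intertwining linear equivalence `e` induces the intertwining `(e⁻¹)ᵗ` of the duals.
[cite: MochizukiAbsTopI2012, Lemma 4.5 (ii) p.54] -/
theorem dualRep_equivariant {ρ : G →* (M ≃ₗ[K] M)} {ρ' : G →* (M' ≃ₗ[K] M')} (e : M ≃ₗ[K] M')
    (he : ∀ g m, e (ρ g m) = ρ' g (e m)) (g : G) (φ : Module.Dual K M) :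
    e.symm.dualMap (dualRep ρ g φ) = dualRep ρ' g (e.symm.dualMap φ) := by
  have h' : ∀ m', (ρ' g).symm m' = e ((ρ g).symm (e.symm m')) := fun m' => by
    apply (ρ' g).injective
    rw [LinearEquiv.apply_symm_apply, ← he, LinearEquiv.apply_symm_apply,
      LinearEquiv.apply_symm_apply]
  ext m'
  simp [dualRep, LinearEquiv.dualMap_apply, h']

/-- **`d_χ(M)` is an invariant of the isomorphism class of the representation.**
[cite: MochizukiAbsTopI2012, Lemma 4.5 (ii) p.54] -/
theorem dChi_eq_of_equivariant [FiniteDimensional K M] [FiniteDimensional K M']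
    {ρ : G →* (M ≃ₗ[K] M)} {ρ' : G →* (M' ≃ₗ[K] M')} (e : M ≃ₗ[K] M')
    (he : ∀ g m, e (ρ g m) = ρ' g (e m)) (χ : G →* Kˣ) : dChi ρ χ = dChi ρ' χ := by
  unfold dChi
  rw [quasiTrivialRank_eq_of_equivariant e (twist_equivariant e he χ⁻¹),
    quasiTrivialRank_eq_of_equivariant e.symm.dualMap (dualRep_equivariant e he)]

end Literature.AnabelianGeometry.AbsoluteAnabelian.AbsTopI
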